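import Literature.MathematicalPhysics.QuantumFieldTheory.Balaban1983to89.B7Prop10Flat
import Literature.MathematicalPhysics.QuantumFieldTheory.Balaban1983to89.B7Eq214

/-!
# `Balaban1983to89.B7Eq214Flat` — T. Bałaban, *Averaging operations for lattice gauge theories*, Commun. Math. Phys.
**98** (1985) 17–51 [Balaban1985Averaging], Sect. F (207)–(214) p. 50: the linearisation `Q′_j(u₁, λ) = (1/i) log ũ′ʲ =
(Q′_jλ) + C′_j(u₁, λ)`, `|C′_j| = O((α₃α₄ + α₄²)Lʲη)` AT THE FLAT BACKGROUND `U₀ = 1` — kernel form with explicit constants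

statement-level skeleton of published theorems with citation tags; proofs where landed; nothing here is a claim about the Yang–Mills mass gap

PDF held: `paper:balaban1985-cmp98-averaging` (journal page = PDF page + 16); render `…/1985-cmp98-averaging-p034-x2.png` (p. 50),
read as an image by the typing seat.

CITATION HEADER (lean-in-tree rule).  lit-balaban SKELETON rows `B7.Eq209`, `B7.Eq213` (PHASE2 nomination of unit r04; the
ABSTRACT-carrier statement of (213)–(214) is `B7Eq214.Eq214Printed`, the level arithmetic (212) ⇒ (214) is `B7Eq214.ineq214_of_212`).
PRINT (p. 50, verbatim): "The assumptions (176), (177) can be reformulated in terms of the functions `λ = (1/i) log u′`. … It is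
obvious from the definition of the averaging operations that `ũ′ʲ` are analytic functions of `λ`, and `Q′_j(u₁, λ) = (1/i) log ũ′ʲ`,
`j ≦ k`, (208) are analytic functions of `λ` also. We want to calculate a linear term in an expansion of this function. In fact, we
will be satisfied with a good approximation of this term. From (184), (187), we have for `v′ = e^{iλ}`
`ṽ′(y) = exp[iλ(y) + i Σ_{x∈B(y)} L^{−d}(R_{0,y}A)(Γ_{y,x}) + O(α₄Lα′₄) + O(L²(α′₃ + α′₄)α′₄)]`. (209) By definition of `A`,
`A_b = (1/i) log e^{−iλ(b₋)}e^{iR_{0,b}λ(b₊)} = (1/i) log e^{−iλ(b₋)}e^{iλ(b₋)+i(D_{V₀}λ)(b)} = (D_{V₀}λ)(b) + O(α₄α′₄ + α′₄²)`, (210)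
hence `(1/i) log ṽ′(y) = Σ_{x∈B(y)} L^{−d}(R_{0,y}λ)(x) + O(α₄Lα′₄ + L²α′₃α′₄ + L²α′₄²)`. (211) By (179) the function `Q′_j(u₁, λ)`
is a composition of one-step functions and from the above formula we can easily see that
`Q′_j(u₁, λ, y) = Σ_{x∈Bʲ(y)} L^{−jd}R(U₀(Γ^{(j)}_{y,x}))λ(x) + Σ_{l=0}^{j−1} O(C₅α₄2α₄Lˡη + α₃2α₄(Lˡη)² + 4α₄²(Lˡη)²)`, (212)
hence `Q′_j(u₁, λ, y) = (Q′_jλ)(y) + C′_j(u₁, λ, y)`, (213) `|C′_j(u₁, λ, y)| = O((α₃α₄ + α₄²)Lʲη)`. (214)"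

WHAT THIS FILE PROVES — the FLAT-BACKGROUND case `U₀ = 1` (so `R_{0,y} = R(U₀(Γ)) = id`, `D_{V₀}λ = ∂λ`, `α₀ = 0`) over the
concrete model of `B7Prop9Flat`/`B7Prop10Flat` (`𝔸` a complete normed `ℂ`-algebra, gauge transformations `ℤ^d → 𝔸ˣ`, the one-step
average `B7Prop9Flat.vtil` (179) and the `j`-fold `B7Prop9Flat.util` (178), `λ := log u′` sitewise, `B7Eq170Flat.bmean` the block mean):
* §1 **`eq210`** — the second-order content of (210): `‖log(e^{−Y}e^{X+Y}) − X‖ ≤ 12‖X‖‖Y‖` for `‖X‖ ≤ 1/10`, `‖Y‖ ≤ 1/25`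
  (`Y = λ(b₋)`, `X = (∂λ)(b)`; from the bilinear (41) `B7Prop9Flat.norm_mlog_exp_add_mul_exp_neg_sub_le` by the rotation (57)).
* §2 **`eq211_flat`** — (209)/(211) at `V₀ = 1` with explicit constants: for `v′, v₁` with (180) (`SiteBd v′ α₄`, `BondBd v′ α′₄`,
  `SiteBd v₁ α₃`, `BlockBd L v₁ q`) and explicit smallness,
  `‖log ṽ′(z) − Σ_{x∈B(Lz)} L^{−d} log v′(x)‖ ≤ 448(d+1)·α₄Lα′₄ + 368(d+1)·Lα′₄q` (`q = Lα′₃` gives print's `L²α′₃α′₄`; no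
  `L²α′₄²`-term is needed at `V₀ = 1`, cf. `B7Prop9Flat` reading (c)), built on `B7Prop9Flat.eq184` ((184)) and `block_walk` ((187)).
* §3 `lamAvg` — the flat linear average `(Q′_jλ)(y) = Σ_{x∈Bʲ(y)} L^{−jd}λ(x)` of (212)/(213), as the `j`-fold block mean — and
  **`eq214_flat`**, **`eq214_flat'`** — (212)–(214) at `U₀ = 1`: under the hypotheses of `B7Prop10Flat.prop10_flat` ((176)/(177) for
  `u′`, `u₁ ∈ Λ_k(1, α₃)`, `L ≥ 2`, `L^kη ≤ 1` and its explicit smallness), for all `j ≤ k`,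
  `‖log ũ′ʲ(y) − (Q′_jλ)(y)‖ ≤ 1792(d+1)C₅(α₃α₄ + α₄²)Lʲη` (`C₅ = B7Prop10Flat.C5 d = 1 + 256(d+1)`), by print's induction over
  the levels with `eq211_flat` as the step (level constants from `prop10_flat`: `rhs204 ≤ C₅α₄`, `rhs203 ≤ 2α₄Lˡη`) and the level sum
  `Σ_{l<j} L^{l+1}η ≤ 2Lʲη` (`B7.sum_pow_succ_le`).
READINGS: those of `B7Prop9Flat`/`B7Prop10Flat` verbatim ((a) flat background only — the general-background `R(U₀(Γ^{(j)}_{y,x}))`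
of (212) is the identity here; (b) Banach reading of `|·|`; (e) explicit smallness; (g) `≤` for `<`); the operator `Q′_j` of B9 (3.19)
over the abstract `Blocking` carrier is `B7Eq78Linearization.QprimeIter` (not instantiated here; `lamAvg` is its flat, unit-transporter
case written directly on `ℤ^d`).  NOT CLAIMED: (213)–(214) at a general background `U₀` (row B7.Eq213 keeps `B7Eq214.Eq214Printed` as
the citation statement); print's unstated `O`-constants.  Unit `lit-balaban-r04` (gen 2), 2026-08-20.
-/

noncomputable section

open NormedSpace Finset

namespace Literature.MathematicalPhysics.QuantumFieldTheory.Balaban1983to89.B7Eq214Flat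

open B7Prop1Explicit MatrixLog B7Eq92Concrete B7Eq99Concrete B7Eq84Concrete B7Eq167Flat B7Eq170Flat B7Prop8Flat B7Prop9Flat
  B7Prop10Flat
open B7Prop6Flat (norm_units_inv_sub_one_le)

export B7Prop1Explicit (Site)

variable {d : ℕ}
variable {𝔸 : Type*} [NormedRing 𝔸] [NormedAlgebra ℂ 𝔸] [CompleteSpace 𝔸]

/-! ## §1 (210): `log(e^{−Y}e^{X+Y}) = X + O(|X||Y|)` -/

omit [NormedAlgebra ℂ 𝔸] [CompleteSpace 𝔸] in
/-- The commutator with a rotation close to the identity: `‖wXw⁻¹ − X‖ ≤ 3t‖X‖` when `‖w − 1‖, ‖w⁻¹ − 1‖ ≤ t ≤ 1`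
(`wXw⁻¹ − X = (w−1)X + X(w⁻¹−1) + (w−1)X(w⁻¹−1)`). [cite: Balaban1985Averaging, (56)–(57) p.27] -/
theorem norm_cj_sub_self_le {w : 𝔸ˣ} {t : ℝ} (hw : ‖(w : 𝔸) - 1‖ ≤ t) (hw' : ‖((w⁻¹ : 𝔸ˣ) : 𝔸) - 1‖ ≤ t) (ht : t ≤ 1)
    (X : 𝔸) : ‖cj w X - X‖ ≤ 3 * t * ‖X‖ := by
  have ht0 : 0 ≤ t := (norm_nonneg _).trans hw
  have hid : cj w X - X = ((w : 𝔸) - 1) * X + X * (((w⁻¹ : 𝔸ˣ) : 𝔸) - 1) +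
      ((w : 𝔸) - 1) * X * (((w⁻¹ : 𝔸ˣ) : 𝔸) - 1) := by
    rw [cj_apply]; noncomm_ring
  rw [hid]
  have hX := norm_nonneg X
  calc _ ≤ ‖((w : 𝔸) - 1) * X‖ + ‖X * (((w⁻¹ : 𝔸ˣ) : 𝔸) - 1)‖ + ‖((w : 𝔸) - 1) * X * (((w⁻¹ : 𝔸ˣ) : 𝔸) - 1)‖ :=
        norm_add₃_le
    _ ≤ t * ‖X‖ + ‖X‖ * t + t * ‖X‖ * t := by
        gcongr
        · exact (norm_mul_le _ _).trans (by gcongr)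
        · exact (norm_mul_le _ _).trans (by gcongr)
        · exact (norm_mul_le _ _).trans
            (mul_le_mul ((norm_mul_le _ _).trans (by gcongr)) hw' (norm_nonneg _) (by positivity))
    _ ≤ 3 * t * ‖X‖ := by
        have h0 : 0 ≤ t * ‖X‖ := by positivity
        have h1 : t * ‖X‖ * t ≤ t * ‖X‖ * 1 := mul_le_mul_of_nonneg_left ht h0
        linarith

/-- **(210)** p. 50, second-order content at `V₀ = 1`, verbatim: *"`A_b = (1/i) log e^{−iλ(b₋)}e^{iR_{0,b}λ(b₊)} =
(1/i) log e^{−iλ(b₋)}e^{iλ(b₋)+i(D_{V₀}λ)(b)} = (D_{V₀}λ)(b) + O(α₄α′₄ + α′₄²)`"* — kernel form: for `‖X‖ ≤ 1/10`, `‖Y‖ ≤ 1/25`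
(`Y = iλ(b₋)`, `X = i(∂λ)(b)`), `‖log(e^{−Y}e^{X+Y}) − X‖ ≤ 12‖X‖‖Y‖` (BILINEAR: no `|X|²`-term in this reading; print's
`O(α′₄²)` is not needed).  Proof: `e^{−Y}e^{X+Y} = R(e^{−Y})[e^{X+Y}e^{−Y}]` (57), `log` commutes with `R` (`B7Eq170Flat.mlog_cj`),
`log(e^{X+Y}e^{−Y}) = X + O(3|X||Y|)` ((41), `B7Prop9Flat.norm_mlog_exp_add_mul_exp_neg_sub_le`), and
`R(e^{−Y})X − X = O(6|X||Y|)` (`norm_cj_sub_self_le`). [cite: Balaban1985Averaging, (210) p.50] -/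
theorem eq210 {X Y : 𝔸} (hX : ‖X‖ ≤ 1 / 10) (hY : ‖Y‖ ≤ 1 / 25) :
    ‖mlog (exp (-Y) * exp (X + Y)) - X‖ ≤ 12 * ‖X‖ * ‖Y‖ := by
  have hX0 := norm_nonneg X
  have hY0 := norm_nonneg Y
  set a : 𝔸ˣ := expUnit (X + Y) with ha
  set b : 𝔸ˣ := expUnit Y with hb
  -- the rotation identity `e^{−Y}e^{X+Y} = R(b⁻¹)(e^{X+Y}e^{−Y})`
  have hrot : exp (-Y) * exp (X + Y) = cj b⁻¹ (exp (X + Y) * exp (-Y)) := by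
    have hu : (b⁻¹ * a : 𝔸ˣ) = Rc b⁻¹ (a * b⁻¹) := by simp only [Rc_apply]; group
    have hv := congrArg (fun u : 𝔸ˣ => (u : 𝔸)) hu
    simpa only [Units.val_mul, val_inv_expUnit, val_expUnit, val_Rc_eq_cj, ha, hb] using hv
  -- bounds on the rotation
  have hb1 : ‖(((b⁻¹ : 𝔸ˣ)) : 𝔸) - 1‖ ≤ 2 * ‖Y‖ := by
    rw [hb, val_inv_expUnit, val_expUnit]
    have h := B7Transfer.norm_exp_sub_one_le_of_le (-Y) (le_of_eq (norm_neg Y))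
    have h2 := exp_sub_one_le_two_mul_of_le hY0 le_rfl (hY.trans (by norm_num))
    linarith
  have hb2 : ‖((((b⁻¹)⁻¹ : 𝔸ˣ)) : 𝔸) - 1‖ ≤ 2 * ‖Y‖ := by
    rw [inv_inv, hb, val_expUnit]
    have h := B7Transfer.norm_exp_sub_one_le_of_le Y le_rfl
    have h2 := exp_sub_one_le_two_mul_of_le hY0 le_rfl (hY.trans (by norm_num))
    linarith
  have hw : ‖(((b⁻¹ : 𝔸ˣ)) : 𝔸) - 1‖ ≤ 2 / 5 := hb1.trans (by linarith)
  have hw' : ‖((((b⁻¹)⁻¹ : 𝔸ˣ)) : 𝔸) - 1‖ ≤ 2 / 5 := hb2.trans (by linarith)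
  -- (41), bilinear
  set ρ : 𝔸 := mlog (exp (X + Y) * exp (-Y)) - X with hρ
  have hρn : ‖ρ‖ ≤ 3 * ‖X‖ * ‖Y‖ := norm_mlog_exp_add_mul_exp_neg_sub_le hX hY
  have hsplit : mlog (exp (-Y) * exp (X + Y)) - X = (cj b⁻¹ X - X) + cj b⁻¹ ρ := by
    rw [hrot, mlog_cj, show mlog (exp (X + Y) * exp (-Y)) = X + ρ by rw [hρ]; abel, cj_add]
    abel
  rw [hsplit]
  calc _ ≤ ‖cj b⁻¹ X - X‖ + ‖cj b⁻¹ ρ‖ := norm_add_le _ _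
    _ ≤ 3 * (2 * ‖Y‖) * ‖X‖ + 2 * ‖ρ‖ :=
        add_le_add (norm_cj_sub_self_le hb1 hb2 (by linarith) X) (norm_cj_le_two_mul hw hw' ρ)
    _ ≤ 12 * ‖X‖ * ‖Y‖ := by nlinarith

/-! ## §2 (209)/(211): the one-step linearisation at `V₀ = 1` -/

omit [CompleteSpace 𝔸] in
/-- `bmean (f − g) = bmean f − bmean g`. [cite: Balaban1985Averaging, (78) p.30] -/
theorem bmean_sub (L : ℕ) (f g : (Fin d → Fin L) → 𝔸) :
    bmean L (fun r => f r - g r) = bmean L f - bmean L g := by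
  simp only [bmean_apply, smul_sub, Finset.sum_sub_distrib]

/-- **(209)/(211) at the flat background, kernel form with explicit constants.**  Print (211): "`(1/i) log ṽ′(y) =
Σ_{x∈B(y)} L^{−d}(R_{0,y}λ)(x) + O(α₄Lα′₄ + L²α′₃α′₄ + L²α′₄²)`" (`λ = (1/i) log v′`, `ṽ′` the one-step average (179)/(184)).
Here, at `V₀ = 1` (`R_{0,y} = id`): for `v′, v₁ : ℤ^d → 𝔸ˣ` with `‖v′ − 1‖ ≤ α₄` (176), `‖v′(b₋)⁻¹v′(b₊) − 1‖ ≤ α′₄` (177),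
`‖v₁ − 1‖ ≤ α₃` (166), `‖v₁(Lz)⁻¹v₁(Lz + r) − 1‖ ≤ q` on the blocks (167; `q = Lα′₃`), and the explicit smallness `0 ≤ α₄ ≤ 1/50`,
`0 ≤ α′₄`, `10³(d+1)Lα′₄ ≤ 1`, `α₃ ≤ 1/5`, `q ≤ 1/50`:
`‖log ṽ′(z) − Σ_{r∈[0,L)^d} L^{−d} log v′(Lz + r)‖ ≤ 448(d+1)·L·α₄α′₄ + 368(d+1)·L·α′₄q`
(`ṽ′ = B7Prop9Flat.vtil L v′ v₁`; the block mean `B7Eq170Flat.bmean`).  Proof = print's: (184) `ṽ′(y) = v′(y)e^{S_{v′}(y) + Φ}`,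
`‖Φ‖ ≤ 92·2θ·q` (`B7Prop9Flat.eq184` with `θ = (d+1)L(α′₄ + 4α′₄²)` from (187) `block_walk`); each summand of `S_{v′}(y)` is
`log(e^{−λ(y)}e^{λ(x)}) = λ(x) − λ(y) + O(12·8θ·2α₄)` by (210) (`eq210`); the final merge `log(e^{λ(y)}e^{S+Φ})` by (31)
(`B7Eq170Flat.exp_mul_exp_eq`, `mlog_exp_of_le`). [cite: Balaban1985Averaging, (209)–(211) p.50] -/
theorem eq211_flat {L : ℕ} (hL : 1 ≤ L) {v' v₁ : Site d → 𝔸ˣ} {α₄ α₄' α₃ q : ℝ}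
    (h4a : SiteBd v' α₄) (h4b : BondBd v' α₄') (h3c : SiteBd v₁ α₃) (hq : BlockBd L v₁ q)
    (hα₄0 : 0 ≤ α₄) (hα₄ : α₄ ≤ 1 / 50) (hα₄' : 0 ≤ α₄') (hs : 1000 * ((d : ℝ) + 1) * L * α₄' ≤ 1)
    (hα₃ : α₃ ≤ 1 / 5) (hq1 : q ≤ 1 / 50) (z : Site d) :
    ‖mlog ((vtil L v' v₁ z : 𝔸ˣ) : 𝔸) -
        bmean L (fun r => mlog ((v' ((L : ℤ) • z + boxVec L r) : 𝔸ˣ) : 𝔸))‖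
      ≤ 448 * ((d : ℝ) + 1) * L * α₄ * α₄' + 368 * ((d : ℝ) + 1) * L * α₄' * q := by
  obtain ⟨hVA, h4, ha0, ha2, hθ0, hθ1, hθ2⟩ := setup hL h4b hα₄' hs
  set θ : ℝ := ((d : ℝ) + 1) * L * (α₄' + 4 * α₄' ^ 2) with hθ
  set y : Site d := (L : ℤ) • z with hy
  have hq0 : 0 ≤ q := (norm_nonneg _).trans (hq z fun _ => ⟨0, hL⟩)
  -- (187) on the block and (184)
  have hb := block_walk ha0 hVA hθ0 (hθ1.trans (by norm_num)) le_rfl y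
  have hw' : ‖((v₁ y : 𝔸ˣ) : 𝔸) - 1‖ ≤ 2 / 5 := (h3c y).trans (by linarith)
  have hw : ‖((((v₁ y)⁻¹ : 𝔸ˣ)) : 𝔸) - 1‖ ≤ 2 / 5 :=
    (norm_units_inv_sub_one_le (v₁ y) ((h3c y).trans (by linarith))).trans (by linarith [h3c y])
  obtain ⟨Φ, hΦ, hΦn⟩ := eq184 (L := L) (v' := v') (v₁ := v₁) (y := y) (p := 2 * θ) (q := q)
    (fun r => (hb r).1) (fun r => hq z r) hw hw' hL (by linarith) hq1
  -- the logarithm `λ = log v′` and the centre value `Y = λ(y)`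
  set lam : Site d → 𝔸 := fun x => mlog ((v' x : 𝔸ˣ) : 𝔸) with hlam
  have hv : ∀ x, v' x = expUnit (lam x) := fun x =>
    Units.ext (by rw [val_expUnit, hlam]; exact (exp_mlog (lt_of_le_of_lt (h4a x) (by linarith))).symm)
  have hlamn : ∀ x, ‖lam x‖ ≤ 2 * α₄ := fun x =>
    (norm_mlog_le_two_mul ((h4a x).trans (by linarith))).trans (by linarith [h4a x])
  set Y : 𝔸 := lam y with hYdef
  have hY : ‖Y‖ ≤ 2 * α₄ := hlamn y
  have hY25 : ‖Y‖ ≤ 1 / 25 := hY.trans (by linarith)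
  -- per block point: `M_r := log v′(y)⁻¹v′(x) = λ(x) − λ(y) + err_r`, `‖err_r‖ ≤ 192θα₄`
  set M : (Fin d → Fin L) → 𝔸 := fun r => mlog ((((v' y)⁻¹ * v' (y + boxVec L r) : 𝔸ˣ)) : 𝔸) with hMdef
  set X : (Fin d → Fin L) → 𝔸 := fun r => lam (y + boxVec L r) - Y with hXdef
  have hMX : ∀ r, ‖M r - X r‖ ≤ 192 * θ * α₄ := by
    intro r
    have hXa : ‖X r‖ ≤ 1 / 10 := by
      calc ‖X r‖ ≤ ‖lam (y + boxVec L r)‖ + ‖Y‖ := norm_sub_le _ _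
        _ ≤ 2 * α₄ + 2 * α₄ := add_le_add (hlamn _) hY
        _ ≤ 1 / 10 := by linarith
    have hval : ((((v' y)⁻¹ * v' (y + boxVec L r) : 𝔸ˣ)) : 𝔸) = exp (-Y) * exp (X r + Y) := by
      rw [hv y, hv (y + boxVec L r), Units.val_mul, val_inv_expUnit, val_expUnit, val_expUnit, hXdef]
      simp only [sub_add_cancel, hYdef]
    have h210 : ‖M r - X r‖ ≤ 12 * ‖X r‖ * ‖Y‖ := by
      rw [hMdef]; simp only; rw [hval]; exact eq210 hXa hY25
    have hMn : ‖M r‖ ≤ 4 * θ := (hb r).2.1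
    -- a priori: ‖X‖ ≤ ‖M‖ + 12‖X‖‖Y‖ ≤ 4θ + 24α₄‖X‖, so ‖X‖ ≤ 8θ
    have hXn : ‖X r‖ ≤ 8 * θ := by
      have h1 : ‖X r‖ ≤ ‖M r‖ + ‖M r - X r‖ := by
        have := norm_sub_le (M r) (M r - X r); simp only [sub_sub_cancel] at this; exact this
      have h2 : 12 * ‖X r‖ * ‖Y‖ ≤ 12 * ‖X r‖ * (2 * α₄) :=
        mul_le_mul_of_nonneg_left hY (by positivity)
      nlinarith [norm_nonneg (X r)]
    calc ‖M r - X r‖ ≤ 12 * ‖X r‖ * ‖Y‖ := h210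
      _ ≤ 12 * (8 * θ) * (2 * α₄) := by gcongr
      _ = 192 * θ * α₄ := by ring
  -- the exponent `S = S_{v′}(y) = bmean λ − Y + bmean err`
  set S : 𝔸 := Sexp L v' y with hSdef
  have hlamfun : (fun r : Fin d → Fin L => mlog ((v' (y + boxVec L r) : 𝔸ˣ) : 𝔸)) =
      fun r => lam (y + boxVec L r) := rfl
  have hS : S = bmean L (fun r => lam (y + boxVec L r)) - Y + bmean L (fun r => M r - X r) := by
    rw [hSdef, Sexp_eq_bmean]
    have h1 : bmean L (fun r => M r - X r) = bmean L M - bmean L X := bmean_sub L M X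
    have h2 : bmean L X = bmean L (fun r => lam (y + boxVec L r)) - Y := by
      rw [hXdef, bmean_sub, bmean_const hL]
    rw [h1, h2, ← hMdef]
    abel
  have hSn : ‖S‖ ≤ 4 * θ := by
    rw [hSdef, Sexp_eq_bmean]; exact norm_bmean_le hL fun r => (hb r).2.1
  have hE : ‖bmean L (fun r => M r - X r)‖ ≤ 192 * θ * α₄ := norm_bmean_le hL hMX
  -- (184) ⇒ ṽ′(z) = e^{Y}·e^{S+Φ} = e^{T}
  have hΦ4 : ‖Φ‖ ≤ 4 * θ := hΦn.trans (by nlinarith)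
  have hSΦ : ‖S + Φ‖ ≤ 8 * θ := (norm_add_le _ _).trans (by linarith)
  have hsum5 : ‖Y‖ + ‖S + Φ‖ ≤ 1 / 5 := by linarith
  set b : 𝔸 := bchRem Y (S + Φ) with hbdef
  have hval : ((vtil L v' v₁ z : 𝔸ˣ) : 𝔸) = exp (Y + (S + Φ) + b) := by
    rw [vtil_apply, ← hy, hΦ, Units.val_mul, val_expUnit, hv y, val_expUnit, ← hYdef, hbdef]
    exact exp_mul_exp_eq hsum5
  have hbch : ‖b‖ ≤ 32 * θ * α₄ := by
    refine (norm_bchRem_le hsum5).trans ?_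
    calc 2 * ‖Y‖ * ‖S + Φ‖ ≤ 2 * (2 * α₄) * (8 * θ) := by gcongr
      _ = 32 * θ * α₄ := by ring
  have hT5 : ‖Y + (S + Φ) + b‖ ≤ 1 / 5 := by
    refine (norm_add_le _ _).trans ?_
    have := norm_add_le Y (S + Φ)
    nlinarith
  have hgoal : mlog ((vtil L v' v₁ z : 𝔸ˣ) : 𝔸) - bmean L (fun r => mlog ((v' (y + boxVec L r) : 𝔸ˣ) : 𝔸)) =
      bmean L (fun r => M r - X r) + Φ + b := by
    rw [hval, mlog_exp_of_le hT5, hlamfun, hS]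
    abel
  rw [hy] at hgoal
  rw [hgoal]
  calc _ ≤ ‖bmean L (fun r => M r - X r)‖ + ‖Φ‖ + ‖b‖ := norm_add₃_le
    _ ≤ 192 * θ * α₄ + 92 * (2 * θ) * q + 32 * θ * α₄ := by linarith
    _ = 224 * θ * α₄ + 184 * θ * q := by ring
    _ ≤ 224 * (2 * (((d : ℝ) + 1) * L * α₄')) * α₄ + 184 * (2 * (((d : ℝ) + 1) * L * α₄')) * q := by
        gcongr
    _ = 448 * ((d : ℝ) + 1) * L * α₄ * α₄' + 368 * ((d : ℝ) + 1) * L * α₄' * q := by ring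

/-! ## §3 (212)–(214) at the flat background -/

/-- **The flat linear average `(Q′_jλ)(y)`** of (212)/(213): "`Σ_{x∈Bʲ(y)} L^{−jd}R(U₀(Γ^{(j)}_{y,x}))λ(x)`" with `U₀ = 1`
(`R = id`), i.e. the `j`-fold block mean of `λ`, defined recursively through the one-level block mean over `B(Lz) = Lz + [0,L)^d`
(coarse coordinates `z`, as (80) `B7Eq84Concrete.uavg`); the general-transporter operator is `B7Eq78Linearization.QprimeIter`
(abstract `Blocking` carrier). [cite: Balaban1985Averaging, (212) p.50] -/
def lamAvg (L : ℕ) : ℕ → (Site d → 𝔸) → Site d → 𝔸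
  | 0, f => f
  | j + 1, f => fun z => bmean L (fun r => lamAvg L j f ((L : ℤ) • z + boxVec L r))

omit [CompleteSpace 𝔸] in
/-- `lamAvg_zero`: `Q′₀λ = λ`. [cite: Balaban1985Averaging, (212) p.50] -/
@[simp] theorem lamAvg_zero (L : ℕ) (f : Site d → 𝔸) : lamAvg L 0 f = f := rfl

omit [CompleteSpace 𝔸] in
/-- `lamAvg_succ`: `(Q′_{j+1}λ)(z) = Σ_{r} L^{−d}(Q′_jλ)(Lz + r)`. [cite: Balaban1985Averaging, (212) p.50] -/
theorem lamAvg_succ (L : ℕ) (j : ℕ) (f : Site d → 𝔸) (z : Site d) :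
    lamAvg L (j + 1) f z = bmean L (fun r => lamAvg L j f ((L : ℤ) • z + boxVec L r)) := rfl

/-- The explicit constant of (214) at the flat background: `C′_flat = 1792(d+1)C₅`, `C₅ = 1 + 4C′₅ = 1 + 256(d+1)`
(`B7Prop10Flat.C5`). [cite: Balaban1985Averaging, (214) p.50] -/
def Cflat (d : ℕ) : ℝ := 1792 * ((d : ℝ) + 1) * C5 d

variable {L : ℕ} {u' u₁ : Site d → 𝔸ˣ} {k : ℕ} {α₃ α₄ η : ℝ}

/-- **(212)–(214) at the flat background, kernel form (sum version).**  Under the hypotheses of Proposition 10 at `U₀ = 1`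
(`B7Prop10Flat.prop10_flat`: (176) `SiteBd u′ α₄`, (177) `BondBd u′ (α₄η)`, `u₁ ∈ Λ_k(1, α₃)`, `L ≥ 2`, `0 ≤ η`, `L^kη ≤ 1`,
`0 ≤ α₃ ≤ 1/50`, `0 ≤ α₄`, `C₅α₄ ≤ 1`, `2000(d+1)Lα₄ ≤ 1`, `C₄(α₃ + α₄) ≤ 1`) plus `50C₅α₄ ≤ 1` (so that the level site
bounds (204) `≤ C₅α₄` stay `≤ 1/50`), for every `j ≤ k` and every `y`:
`‖log ũ′ʲ(y) − (Q′_jλ)(y)‖ ≤ 896(d+1)C₅(α₃α₄ + α₄²)·Σ_{l<j} L^{l+1}η` — print (212): "`Q′_j(u₁, λ, y) = Σ_{x∈Bʲ(y)} L^{−jd}…λ(x)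
+ Σ_{l=0}^{j−1} O(C₅α₄2α₄Lˡη + α₃2α₄(Lˡη)² + 4α₄²(Lˡη)²)`" (`λ = log u′`, `ũ′ʲ = B7Prop9Flat.util L u′ u₁ j`,
`Q′_jλ = lamAvg L j λ`).  Induction over the levels: the step is `eq211_flat` for `v′ = ũ′ˡ`, `v₁ = ū₁ˡ` with the level
constants of `prop10_flat` ((204) `≤ C₅α₄`, (203) `≤ 2α₄Lˡη`, (166)/(167) for `ū₁ˡ`), and the block mean does not increase the
sup norm of the accumulated error. [cite: Balaban1985Averaging, (212) p.50] -/
theorem eq212_flat (hL : 2 ≤ L) (h176 : SiteBd u' α₄) (h177 : BondBd u' (α₄ * η))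
    (hu₁ : InLambda L (1 : Site d → Fin d → 𝔸ˣ) u₁ k α₃ η)
    (hη : 0 ≤ η) (hk : (L : ℝ) ^ k * η ≤ 1) (hα₃ : 0 ≤ α₃) (hα₃' : α₃ ≤ 1 / 50) (hα₄ : 0 ≤ α₄)
    (hs₁ : C5 d * α₄ ≤ 1) (hs₂ : 2000 * ((d : ℝ) + 1) * L * α₄ ≤ 1) (hs₃ : C4 d * (α₃ + α₄) ≤ 1)
    (hs₄ : 50 * C5 d * α₄ ≤ 1) :
    ∀ j ≤ k, ∀ z : Site d,
      ‖mlog ((util L u' u₁ j z : 𝔸ˣ) : 𝔸) - lamAvg L j (fun x => mlog ((u' x : 𝔸ˣ) : 𝔸)) z‖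
        ≤ 896 * ((d : ℝ) + 1) * C5 d * (α₃ * α₄ + α₄ ^ 2) * ∑ i ∈ range j, (L : ℝ) ^ (i + 1) * η := by
  have hL1 : 1 ≤ L := le_trans (by norm_num) hL
  have hLr : (1 : ℝ) ≤ L := by exact_mod_cast hL1
  have hd1 : (1 : ℝ) ≤ (d : ℝ) + 1 := by have := Nat.cast_nonneg (α := ℝ) d; linarith
  have hC5 : (1 : ℝ) ≤ C5 d := one_le_C5
  have h167 := (cond167_one_left_iff L u₁ k α₃ η).1 hu₁.2
  have h166 := hu₁.1
  have hP10 := prop10_flat hL h176 h177 hu₁ hη hk hα₃ hα₃' hα₄ hs₁ hs₂ hs₃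
  set K : ℝ := 896 * ((d : ℝ) + 1) * C5 d * (α₃ * α₄ + α₄ ^ 2) with hK
  have hK0 : 0 ≤ K := by rw [hK]; have := C5'_nonneg (d := d); unfold C5; positivity
  intro j
  induction j with
  | zero =>
    intro _ z
    simp [util_zero]
  | succ j ih =>
    intro hjk z
    have hjlt : j < k := Nat.lt_of_succ_le hjk
    have hIH := ih hjlt.le
    obtain ⟨hB, hSd⟩ := hP10 j hjlt.le
    -- scale parameters
    obtain ⟨ht1, -⟩ := pow_eta_le hL1 hη hk hjlt.le
    obtain ⟨ht1', -⟩ := pow_eta_le hL1 hη hk (Nat.succ_le_of_lt hjlt)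
    set t : ℝ := (L : ℝ) ^ j * η with ht
    have ht0 : 0 ≤ t := by positivity
    -- level constants: (204) ≤ C₅α₄, (203) ≤ 2α₄t
    have h204 : rhs204 d L j α₄ η ≤ C5 d * α₄ := rhs204_le hL hα₄ hη ht1
    have h203 : rhs203 d L j α₃ α₄ η ≤ 2 * α₄ * t := rhs203_le hα₄ hη ht1 hs₃
    have h203' : 0 ≤ rhs203 d L j α₃ α₄ η := by
      unfold rhs203; unfold C4 C5; have := C4'_nonneg (d := d); have := C5'_nonneg (d := d); positivity
    -- the one-step lemma at level `j`
    set u : ℝ := (L : ℝ) ^ (j + 1) * η with hu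
    have hu' : u = (L : ℝ) * t := by rw [hu, ht, pow_succ]; ring
    have hu0 : 0 ≤ u := by positivity
    have hstep : ∀ z : Site d,
        ‖mlog ((vtil L (util L u' u₁ j) (uavg L 1 u₁ j) z : 𝔸ˣ) : 𝔸) -
            bmean L (fun r => mlog ((util L u' u₁ j ((L : ℤ) • z + boxVec L r) : 𝔸ˣ) : 𝔸))‖
          ≤ 448 * ((d : ℝ) + 1) * L * (C5 d * α₄) * (2 * α₄ * t) +
              368 * ((d : ℝ) + 1) * L * (2 * α₄ * t) * (α₃ * (L : ℝ) ^ (j + 1) * η) := by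
      intro z
      refine eq211_flat hL1 (siteBd_mono hSd h204) (bondBd_mono hB h203) (fun x => h166 j hjlt.le x)
        (fun z r => h167 j hjlt z r) (by positivity) ?_ (by positivity) ?_ (hα₃'.trans (by norm_num)) ?_ z
      · nlinarith
      · calc 1000 * ((d : ℝ) + 1) * L * (2 * α₄ * t) = (2000 * ((d : ℝ) + 1) * L * α₄) * t := by ring
          _ ≤ 1 * 1 := mul_le_mul hs₂ ht1 ht0 (by positivity)
          _ = 1 := by ring
      · calc α₃ * (L : ℝ) ^ (j + 1) * η = α₃ * u := by rw [hu]; ring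
          _ ≤ α₃ * 1 := mul_le_mul_of_nonneg_left ht1' hα₃
          _ ≤ 1 / 50 := by linarith
    -- the step bound is ≤ K·L^{j+1}η
    have herr : 448 * ((d : ℝ) + 1) * L * (C5 d * α₄) * (2 * α₄ * t) +
        368 * ((d : ℝ) + 1) * L * (2 * α₄ * t) * (α₃ * (L : ℝ) ^ (j + 1) * η) ≤ K * u := by
      have hq' : α₃ * (L : ℝ) ^ (j + 1) * η = α₃ * u := by rw [hu]; ring
      rw [hq', hK]
      have hLt0 : 0 ≤ (L : ℝ) * t := by positivity
      have e1 : 448 * ((d : ℝ) + 1) * L * (C5 d * α₄) * (2 * α₄ * t) +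
          368 * ((d : ℝ) + 1) * L * (2 * α₄ * t) * (α₃ * u) =
          896 * ((d : ℝ) + 1) * C5 d * α₄ ^ 2 * u + 736 * ((d : ℝ) + 1) * (α₃ * α₄) * (u * u) := by
        rw [hu']; ring
      rw [e1]
      have e2 : u * u ≤ u := by nlinarith
      have e3 : 736 * ((d : ℝ) + 1) * (α₃ * α₄) * (u * u) ≤ 736 * ((d : ℝ) + 1) * (α₃ * α₄) * u :=
        mul_le_mul_of_nonneg_left e2 (by positivity)
      have e4 : 736 * ((d : ℝ) + 1) * (α₃ * α₄) * u ≤ 896 * ((d : ℝ) + 1) * C5 d * (α₃ * α₄) * u := by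
        have h0 : 0 ≤ ((d : ℝ) + 1) * (α₃ * α₄) * u := by positivity
        nlinarith
      have e5 : 896 * ((d : ℝ) + 1) * C5 d * α₄ ^ 2 * u + 896 * ((d : ℝ) + 1) * C5 d * (α₃ * α₄) * u =
          896 * ((d : ℝ) + 1) * C5 d * (α₃ * α₄ + α₄ ^ 2) * u := by ring
      linarith
    -- assemble: D_{j+1}(z) = [step] + bmean(D_j)
    rw [util_succ, lamAvg_succ]
    have hDj : ‖bmean L (fun r => mlog ((util L u' u₁ j ((L : ℤ) • z + boxVec L r) : 𝔸ˣ) : 𝔸)) -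
        bmean L (fun r => lamAvg L j (fun x => mlog ((u' x : 𝔸ˣ) : 𝔸)) ((L : ℤ) • z + boxVec L r))‖
          ≤ K * ∑ i ∈ range j, (L : ℝ) ^ (i + 1) * η := by
      rw [← bmean_sub]
      exact norm_bmean_le hL1 fun r => hIH _
    calc _ ≤ ‖mlog ((vtil L (util L u' u₁ j) (uavg L 1 u₁ j) z : 𝔸ˣ) : 𝔸) -
            bmean L (fun r => mlog ((util L u' u₁ j ((L : ℤ) • z + boxVec L r) : 𝔸ˣ) : 𝔸))‖ +
          ‖bmean L (fun r => mlog ((util L u' u₁ j ((L : ℤ) • z + boxVec L r) : 𝔸ˣ) : 𝔸)) -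
            bmean L (fun r => lamAvg L j (fun x => mlog ((u' x : 𝔸ˣ) : 𝔸)) ((L : ℤ) • z + boxVec L r))‖ :=
          norm_sub_le_norm_sub_add_norm_sub _ _ _
      _ ≤ K * u + K * ∑ i ∈ range j, (L : ℝ) ^ (i + 1) * η :=
          add_le_add ((hstep z).trans herr) hDj
      _ = K * ∑ i ∈ range (j + 1), (L : ℝ) ^ (i + 1) * η := by rw [sum_range_succ, hu]; ring

/-- **(213)–(214) at the flat background, kernel form.**  Print: "`Q′_j(u₁, λ, y) = (Q′_jλ)(y) + C′_j(u₁, λ, y)`, (213)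
`|C′_j(u₁, λ, y)| = O((α₃α₄ + α₄²)Lʲη)`. (214)"  At `U₀ = 1`, under the hypotheses of `eq212_flat` (= those of
`B7Prop10Flat.prop10_flat`): for all `j ≤ k` and all `y`, `‖log ũ′ʲ(y) − (Q′_jλ)(y)‖ ≤ C′_flat·(α₃α₄ + α₄²)·Lʲη` with the explicit
`C′_flat = Cflat d = 1792(d+1)C₅` (with the extra explicit smallness `50C₅α₄ ≤ 1`) — from `eq212_flat` and `Σ_{l<j} L^{l+1}η ≤ 2Lʲη` (`L ≥ 2`, `B7.sum_pow_succ_le`; the level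
bookkeeping (212) ⇒ (214) in print's letters is `B7Eq214.ineq214_of_212`). [cite: Balaban1985Averaging, (213)–(214) p.50] -/
theorem eq214_flat (hL : 2 ≤ L) (h176 : SiteBd u' α₄) (h177 : BondBd u' (α₄ * η))
    (hu₁ : InLambda L (1 : Site d → Fin d → 𝔸ˣ) u₁ k α₃ η)
    (hη : 0 ≤ η) (hk : (L : ℝ) ^ k * η ≤ 1) (hα₃ : 0 ≤ α₃) (hα₃' : α₃ ≤ 1 / 50) (hα₄ : 0 ≤ α₄)
    (hs₁ : C5 d * α₄ ≤ 1) (hs₂ : 2000 * ((d : ℝ) + 1) * L * α₄ ≤ 1) (hs₃ : C4 d * (α₃ + α₄) ≤ 1)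
    (hs₄ : 50 * C5 d * α₄ ≤ 1) :
    ∀ j ≤ k, ∀ z : Site d,
      ‖mlog ((util L u' u₁ j z : 𝔸ˣ) : 𝔸) - lamAvg L j (fun x => mlog ((u' x : 𝔸ˣ) : 𝔸)) z‖
        ≤ Cflat d * (α₃ * α₄ + α₄ ^ 2) * ((L : ℝ) ^ j * η) := by
  intro j hj z
  have hLr : (2 : ℝ) ≤ L := by exact_mod_cast hL
  have h := eq212_flat hL h176 h177 hu₁ hη hk hα₃ hα₃' hα₄ hs₁ hs₂ hs₃ hs₄ j hj z
  have hs := B7.sum_pow_succ_le (L : ℝ) η hLr hη j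
  have h0 : 0 ≤ 896 * ((d : ℝ) + 1) * C5 d * (α₃ * α₄ + α₄ ^ 2) := by
    have := C5'_nonneg (d := d); unfold C5; positivity
  calc _ ≤ _ := h
    _ ≤ 896 * ((d : ℝ) + 1) * C5 d * (α₃ * α₄ + α₄ ^ 2) * (2 * ((L : ℝ) ^ j * η)) :=
        mul_le_mul_of_nonneg_left hs h0
    _ = Cflat d * (α₃ * α₄ + α₄ ^ 2) * ((L : ℝ) ^ j * η) := by rw [Cflat]; ring

end Literature.MathematicalPhysics.QuantumFieldTheory.Balaban1983to89.B7Eq214Flat
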